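import Summits.Ventures.CertifiedArithmetic.LowPrec.SRPythagorasWholeRangeGeneric
import Summits.Ventures.CertifiedArithmetic.LowPrec.SRPythagorasAllSigns
import HarnessLib

/-!
# SR CI — StochasticA with `N` random bits is drift-antitone on EVERY unsaturated outcome tree of a
binary format **iff** `N ≥ emaxCode − 1`

HONEST FRAMING: certified error envelopes and provably optimal rounding/accumulation schemes for
low-precision formats under stated cost models; every table by two implementations; no hardware or
vendor claims.

XCVIII (`SRPythagorasAllSigns`) proved the sufficiency half on the whole range of every format:
with `N ≥ emaxCode − 1` bits, limited-randomness stochastic rounding `StochasticA = SR_{p,N}`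
(round up with probability `A_N(η) = ⌊η 2^N⌋ / 2^N`) is drift-antitone on every outcome tree whose
pre-rounding values stay in the hull (`NoSat`), hence obeys the Pythagorean mean-square law for
every `n` and any signs.  XCIX / C exhibited ONE failing tree with `emaxCode − 2` bits.

This file closes the gap below: for EVERY `N ≤ emaxCode − 2` there is an unsaturated two-summand
tree inside `[0, maxRat]` on which `A_N` is not drift-antitone (and `A_(N+1)` is).  With
`j = emaxCode − 2 − N`, `B = 2^(manBits+j)·q` (first value of binade `j`, spacing `d = 2^j·q`) and
`T = 2^(manBits+emaxCode−1)·q` (first value of the top binade, spacing `G = 2^(N+1)·d`), the tree is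
`B;  d/2,  T + d − B`: the first step has candidates `B`, `B + d`; the second pre-rounding values are
`T + d` (residual `2^−(N+1)`: killed by `N` bits, drift `T − B`) and `T + 2d` (residual `2^−N`, exact:
drift `T − B + d`, LARGER from the larger candidate).  For `N = 0` the second value `T + 2d = T + G`
is a grid point.  Consequently (`valueSet_stochasticA_driftAntitone_iff`), for every format with at
least two values in its top binade (`1 ≤ topMan`; every catalogued format):

  `(∀ x n s, NoSat (valueSet φ) x n s → DriftAntitone (valueSet φ) (A_N) x n s) ↔ emaxCode − 1 ≤ N`,

with no hypothesis on `emaxCode` (for `emaxCode ≤ 1` both sides hold).  Instances: E2M1/E2M3 `↔ 2 ≤ N`,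
E3M2 `↔ 6 ≤ N`, E4M3 `↔ 14 ≤ N`, E5M2 and binary16 `↔ 29 ≤ N`, bfloat16 and binary32 `↔ 253 ≤ N`.

Scope (honest): this is the exact threshold of the SUFFICIENT CONDITION (drift-antitonicity) behind
the Pythagorean law of XC–XCVIII; below the threshold the law is only known to fail on specific trees
for other rules (XCII), and the witnesses here are pathological (a half-spacing step low in the range
followed by a jump into the top binade).  Formats with a single value in the top binade (`topMan = 0`)
are not covered.
-/

namespace Summit.Ventures.CertifiedArithmetic.LowPrec.SR.LimitedBits

open Literature.ComputerArithmetic.ConnollyHighamMary2021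
open Literature.ComputerArithmetic.FloatingPoint (Format MiniFloat)
open Literature.ComputerArithmetic.FloatingPoint.MiniFloat (valueSet valueSet_nonempty toRat_mem_valueSet)
open Summit.Ventures.CertifiedArithmetic.LowPrec.SR
open Finset

/-- `NoSat` of a two-summand tree, unfolded. -/
theorem noSat_two_iff (F : Finset ℚ) (x0 x1 s : ℚ) :
    NoSat F (seqL [x0, x1]) 2 s ↔
      InHull F (s + x0) ∧ InHull F (up F (s + x0) + x1) ∧ InHull F (dn F (s + x0) + x1) := by
  simp only [NoSat, seqL, List.getD_cons_zero, List.getD_cons_succ, and_true]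

/-- At a grid point the step mean is the point, whatever the probability rule. -/
theorem stepQ_id_of_mem {F : Finset ℚ} (qf : ℚ → ℚ) {c : ℚ} (hc : c ∈ F) :
    stepQ F qf c (fun y => y) = c := by
  have hin : InHull F c := ⟨⟨c, hc, le_rfl⟩, ⟨c, hc, le_rfl⟩⟩
  have hd : dn F c = c := by unfold dn; rw [clamp_eq_self hin, roundDown_eq_self_of_mem hc]
  have hu : up F c = c := by unfold up; rw [clamp_eq_self hin, roundUp_eq_self_of_mem hc]
  unfold stepQ; rw [hd, hu]; ring

variable (φ : Format)

/-! ### Binade `j`: its first two values and the cell between them -/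

/-- The first value `2^(manBits + j)·q` of binade `j < emaxCode`. -/
theorem binadeStart_mem_valueSet {j : ℕ} (hj : j + 1 ≤ φ.emaxCode) :
    (2 : ℚ) ^ (φ.manBits + j) * φ.quantum ∈ valueSet φ := by
  obtain ⟨a, ha⟩ : ∃ a, φ.emaxCode = a + 1 := ⟨φ.emaxCode - 1, by omega⟩
  have hr : φ.Representable (2 ^ φ.manBits * 2 ^ j) := by
    refine MiniFloat.representable_mul_pow (Nat.pow_lt_pow_right (by norm_num) (by omega)) ?_
    rw [maxScaled_eq_of_emaxCode φ ha]
    exact Nat.mul_le_mul (Nat.le_add_right _ _) (Nat.pow_le_pow_right (by norm_num) (by omega))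
  have h := natMul_mem_of_representable hr
  rw [Nat.cast_mul, Nat.cast_pow, Nat.cast_pow, ← pow_add] at h
  exact_mod_cast h

/-- The second value `(2^(manBits + j) + 2^j)·q` of binade `j < emaxCode` (needs `topMan ≥ 1` in the
top binade; automatic below it, but one hypothesis keeps the statement uniform). -/
theorem binadeNext_mem_valueSet {j : ℕ} (hj : j + 1 ≤ φ.emaxCode) (ht : 1 ≤ φ.topMan) :
    ((2 : ℚ) ^ (φ.manBits + j) + 2 ^ j) * φ.quantum ∈ valueSet φ := by
  obtain ⟨a, ha⟩ : ∃ a, φ.emaxCode = a + 1 := ⟨φ.emaxCode - 1, by omega⟩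
  have hM := φ.topMan_lt
  have hr : φ.Representable ((2 ^ φ.manBits + 1) * 2 ^ j) := by
    refine MiniFloat.representable_mul_pow ?_ ?_
    · have : 2 ^ (φ.manBits + 1) = 2 * 2 ^ φ.manBits := by ring
      omega
    · rw [maxScaled_eq_of_emaxCode φ ha]
      exact Nat.mul_le_mul (by omega) (Nat.pow_le_pow_right (by norm_num) (by omega))
  have h := natMul_mem_of_representable hr
  have e : (((2 ^ φ.manBits + 1) * 2 ^ j : ℕ) : ℚ) = 2 ^ (φ.manBits + j) + 2 ^ j := by push_cast; ring
  rwa [e] at h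

/-- Inside the first cell of binade `j`: the candidates are its two ends and the value is in the hull. -/
theorem binadeCell {j : ℕ} (hj : j + 1 ≤ φ.emaxCode) (ht : 1 ≤ φ.topMan) {c : ℚ}
    (hBc : (2 : ℚ) ^ (φ.manBits + j) * φ.quantum < c)
    (hcB : c < ((2 : ℚ) ^ (φ.manBits + j) + 2 ^ j) * φ.quantum) :
    dn (valueSet φ) c = (2 : ℚ) ^ (φ.manBits + j) * φ.quantum ∧
      up (valueSet φ) c = ((2 : ℚ) ^ (φ.manBits + j) + 2 ^ j) * φ.quantum ∧ InHull (valueSet φ) c := by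
  have hBm := binadeStart_mem_valueSet φ hj
  have hNm := binadeNext_mem_valueSet φ hj ht
  have hin : InHull (valueSet φ) c := ⟨⟨_, hBm, hBc.le⟩, ⟨_, hNm, hcB.le⟩⟩
  refine ⟨?_, ?_, hin⟩
  · unfold dn; rw [clamp_eq_self hin]
    have hmem : roundDown (valueSet φ) c ∈ valueSet φ := roundDown_mem ⟨_, hBm, hBc.le⟩
    have hge := le_roundDown_of_mem hBm hBc.le
    have hle : roundDown (valueSet φ) c ≤ c := roundDown_le _ _
    by_contra hne
    have := topNext_le_of_mem_gt φ hmem (lt_of_le_of_ne hge (Ne.symm hne))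
    linarith
  · unfold up; rw [clamp_eq_self hin]
    have hmem : roundUp (valueSet φ) c ∈ valueSet φ := roundUp_mem ⟨_, hNm, hcB.le⟩
    have hge : c ≤ roundUp (valueSet φ) c := le_roundUp _ _
    have hle := roundUp_le_of_mem hNm hcB.le
    exact le_antisymm hle (topNext_le_of_mem_gt φ hmem (lt_of_lt_of_le hBc hge))

/-! ### The witness for every bit count below the threshold -/

/-- **Below the threshold, every bit count fails somewhere** (equational form).  For `N + j + 2 =
emaxCode` and `topMan ≥ 1`, with `s = 2^(manBits+j)·q`, `x0 = 2^j·q/2`,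
`x1 = 2^(manBits+N+j+1)·q + 2^j·q − s` and `hi = maxRat`: the tree `s; x0, x1` stays in `[0, hi]`,
is unsaturated, is NOT drift-antitone under `A_N` and IS drift-antitone under `A_(N+1)`. -/
theorem valueSet_bits_below_threshold_fail' {N j : ℕ} (hj : N + j + 2 = φ.emaxCode)
    (ht : 1 ≤ φ.topMan) {s x0 x1 hi : ℚ} (hs : (2 : ℚ) ^ (φ.manBits + j) * φ.quantum = s)
    (hx0 : (2 : ℚ) ^ j * φ.quantum / 2 = x0)
    (hx1 : (2 : ℚ) ^ (φ.manBits + (N + j + 1)) * φ.quantum + 2 ^ j * φ.quantum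
        - 2 ^ (φ.manBits + j) * φ.quantum = x1)
    (hhi : φ.maxRat = hi) :
    InWindow (valueSet φ) 0 hi (seqL [x0, x1]) 2 s ∧ NoSat (valueSet φ) (seqL [x0, x1]) 2 s ∧
      ¬ DriftAntitone (valueSet φ) (probAwayA N) (seqL [x0, x1]) 2 s ∧
        DriftAntitone (valueSet φ) (probAwayA (N + 1)) (seqL [x0, x1]) 2 s := by
  subst hs hx0 hx1 hhi
  have hq := φ.quantum_pos
  have hjl : j + 1 ≤ φ.emaxCode := by omega
  have htop : (N + j + 1) + 1 ≤ φ.emaxCode := by omega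
  have ha : φ.emaxCode = (N + j + 1) + 1 := by omega
  -- membership / cell facts, stated before abbreviating
  have hTm := binadeStart_mem_valueSet φ htop
  have hTNm := binadeNext_mem_valueSet φ htop ht
  have hTNle := topNext_le_maxRat φ ha ht
  have cellB := fun {c : ℚ} (h1 : (2 : ℚ) ^ (φ.manBits + j) * φ.quantum < c)
      (h2 : c < ((2 : ℚ) ^ (φ.manBits + j) + 2 ^ j) * φ.quantum) => binadeCell φ hjl ht h1 h2
  have cellT := fun {c : ℚ} (h1 : (2 : ℚ) ^ (φ.manBits + (N + j + 1)) * φ.quantum < c)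
      (h2 : c < ((2 : ℚ) ^ (φ.manBits + (N + j + 1)) + 2 ^ (N + j + 1)) * φ.quantum) =>
    binadeCell φ htop ht h1 h2
  set q := φ.quantum with hq_def
  set d : ℚ := 2 ^ j * q with hd_def
  set B : ℚ := 2 ^ (φ.manBits + j) * q with hB_def
  set T : ℚ := 2 ^ (φ.manBits + (N + j + 1)) * q with hT_def
  set G : ℚ := 2 ^ (N + j + 1) * q with hG_def
  have hBd : ((2 : ℚ) ^ (φ.manBits + j) + 2 ^ j) * q = B + d := by rw [hB_def, hd_def]; ring
  have hTG : ((2 : ℚ) ^ (φ.manBits + (N + j + 1)) + 2 ^ (N + j + 1)) * q = T + G := by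
    rw [hT_def, hG_def]; ring
  have hd0 : 0 < d := by positivity
  have hB0 : 0 ≤ B := by positivity
  have hT0 : 0 ≤ T := by positivity
  have hBT : B ≤ T := by
    rw [hB_def, hT_def]
    exact mul_le_mul_of_nonneg_right (pow_le_pow_right₀ (by norm_num) (by omega)) hq.le
  have hGd : G = 2 ^ (N + 1) * d := by rw [hG_def, hd_def]; ring
  have hGd' : 2 * d ≤ G := by
    rw [hGd]
    exact mul_le_mul_of_nonneg_right (by
      calc (2 : ℚ) = 2 ^ 1 := by norm_num
        _ ≤ 2 ^ (N + 1) := pow_le_pow_right₀ (by norm_num) (by omega)) hd0.le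
  have hdG : d < G := by linarith
  -- step 0: candidates B and B + d
  obtain ⟨d0, u0, in0⟩ := cellB (c := B + d / 2) (by linarith) (by rw [hBd]; linarith)
  rw [hBd] at u0
  have hc1 : B + (T + d - B) = T + d := by ring
  have hc2 : B + d + (T + d - B) = T + 2 * d := by ring
  have hmax : T + G ≤ φ.maxRat := by rw [← hTG]; exact hTNle
  -- value 1: interior of the top cell, residual 2^-(N+1)
  obtain ⟨d1, u1, in1⟩ := cellT (c := T + d) (by linarith) (by rw [hTG]; linarith)
  rw [hTG] at u1
  have p1 : pUp (valueSet φ) (T + d) = 1 / 2 ^ (N + 1) := by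
    rw [pUp_eq_div_of_inHull in1, d1, u1, hGd]; field_simp; ring
  have s1a : stepQ (valueSet φ) (probAwayA N) (T + d) (fun y => y) = T := by
    rw [stepQ_id_probAwayA N (by rw [d1]; exact hT0), p1, probAwayA_half_grid, d1]; ring
  have s1b : stepQ (valueSet φ) (probAwayA (N + 1)) (T + d) (fun y => y) = T + d := by
    rw [stepQ_id_probAwayA (N + 1) (by rw [d1]; exact hT0), p1,
      probAwayA_eq_self_of_grid (N + 1) 1 (by push_cast; field_simp), d1, u1, hGd]
    field_simp; ring
  -- value 2: residual 2^-N (interior for N ≥ 1, the grid point T + G for N = 0)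
  obtain ⟨in2, s2a, s2b⟩ : InHull (valueSet φ) (T + 2 * d) ∧
      stepQ (valueSet φ) (probAwayA N) (T + 2 * d) (fun y => y) = T + 2 * d ∧
        stepQ (valueSet φ) (probAwayA (N + 1)) (T + 2 * d) (fun y => y) = T + 2 * d := by
    rcases Nat.eq_zero_or_pos N with hN0 | hN1
    · subst hN0
      have hG2 : G = 2 * d := by rw [hGd]; ring
      have hmem : T + 2 * d ∈ valueSet φ := by rw [← hG2, ← hTG]; exact hTNm
      exact ⟨⟨⟨_, hmem, le_rfl⟩, ⟨_, hmem, le_rfl⟩⟩, stepQ_id_of_mem _ hmem, stepQ_id_of_mem _ hmem⟩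
    · have hG4 : 4 * d ≤ G := by
        rw [hGd]
        exact mul_le_mul_of_nonneg_right (by
          calc (4 : ℚ) = 2 ^ 2 := by norm_num
            _ ≤ 2 ^ (N + 1) := pow_le_pow_right₀ (by norm_num) (by omega)) hd0.le
      obtain ⟨d2, u2, in2⟩ := cellT (c := T + 2 * d) (by linarith) (by rw [hTG]; linarith)
      rw [hTG] at u2
      obtain ⟨M, hM⟩ : ∃ M, N = M + 1 := ⟨N - 1, by omega⟩
      subst hM
      have p2 : pUp (valueSet φ) (T + 2 * d) = 1 / 2 ^ (M + 1) := by
        rw [pUp_eq_div_of_inHull in2, d2, u2, hGd, pow_succ]; field_simp; ring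
      refine ⟨in2, ?_, ?_⟩
      · rw [stepQ_id_probAwayA (M + 1) (by rw [d2]; exact hT0), p2,
          probAwayA_eq_self_of_grid (M + 1) 1 (by push_cast; field_simp), d2, u2, hGd, pow_succ]
        field_simp; ring
      · rw [stepQ_id_probAwayA (M + 1 + 1) (by rw [d2]; exact hT0), p2,
          probAwayA_eq_self_of_grid (M + 1 + 1) 2 (by rw [pow_succ (2 : ℚ) (M + 1)]; push_cast; field_simp), d2, u2,
          hGd, pow_succ, pow_succ]
        field_simp; ring
  refine ⟨?_, ?_, ?_, ?_⟩
  · rw [inWindow_two_iff, u0, d0, hc1, hc2, clamp_eq_self in0, clamp_eq_self in1, clamp_eq_self in2]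
    exact ⟨⟨by positivity, by linarith⟩, ⟨by positivity, by linarith⟩, ⟨by positivity, by linarith⟩⟩
  · rw [noSat_two_iff, u0, d0, hc1, hc2]
    exact ⟨in0, in2, in1⟩
  · rw [driftAntitone_two_iff, u0, d0, hc1, hc2, s2a, s1a]
    intro h; linarith
  · rw [driftAntitone_two_iff, u0, d0, hc1, hc2, s2b, s1b]
    linarith

/-- **Below the threshold, every bit count fails somewhere** (direct form): for `N + 2 ≤ emaxCode` and
`topMan ≥ 1` there is an unsaturated two-summand tree inside `[0, maxRat]` on which `A_N` is not
drift-antitone while `A_(N+1)` is. -/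
theorem valueSet_bits_below_threshold_fail {N : ℕ} (hN : N + 2 ≤ φ.emaxCode) (ht : 1 ≤ φ.topMan) :
    ∃ x0 x1 s : ℚ, InWindow (valueSet φ) 0 φ.maxRat (seqL [x0, x1]) 2 s ∧
      NoSat (valueSet φ) (seqL [x0, x1]) 2 s ∧
        ¬ DriftAntitone (valueSet φ) (probAwayA N) (seqL [x0, x1]) 2 s ∧
          DriftAntitone (valueSet φ) (probAwayA (N + 1)) (seqL [x0, x1]) 2 s :=
  ⟨_, _, _, valueSet_bits_below_threshold_fail' φ (j := φ.emaxCode - 2 - N) (by omega) ht rfl rfl rfl rfl⟩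

/-- **THE THRESHOLD THEOREM.**  For every binary format with at least two values in its top binade:
`StochasticA` with `N` random bits is drift-antitone on every unsaturated outcome tree (every `n`, every
start, any signs) iff `N ≥ emaxCode − 1`.  (`←` is XCVIII `valueSet_stochasticA_all`; `→` is the
witness family above.) -/
theorem valueSet_stochasticA_driftAntitone_iff (ht : 1 ≤ φ.topMan) (N : ℕ) :
    (∀ (x : ℕ → ℚ) (n : ℕ) (s : ℚ), NoSat (valueSet φ) x n s →
        DriftAntitone (valueSet φ) (probAwayA N) x n s) ↔ φ.emaxCode - 1 ≤ N := by
  refine ⟨fun h => ?_, fun hN x n s hns => (valueSet_stochasticA_all φ hN x n s hns).1⟩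
  by_contra hlt
  obtain ⟨x0, x1, s, -, hns, hna, -⟩ := valueSet_bits_below_threshold_fail φ (N := N) (by omega) ht
  exact hna (h _ _ _ hns)

/-- The same with the Pythagorean mean-square bound attached on the `←` side (XCVIII), for reference:
above the threshold the law holds on every unsaturated tree. -/
theorem valueSet_stochasticA_law_of_threshold (ht : 1 ≤ φ.topMan) {N : ℕ}
    (h : ∀ (x : ℕ → ℚ) (n : ℕ) (s : ℚ), NoSat (valueSet φ) x n s →
        DriftAntitone (valueSet φ) (probAwayA N) x n s)
    (x : ℕ → ℚ) (n : ℕ) (s : ℚ) (hns : NoSat (valueSet φ) x n s) :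
    accExpQ (valueSet φ) (probAwayA N) x n (fun t => (t - (s + ∑ i ∈ range n, x i)) ^ 2) s
      ≤ n * ((2 ^ (φ.emaxCode - 1) * φ.quantum) ^ 2 / 4)
        + (n * (1 / 2 ^ N * (2 ^ (φ.emaxCode - 1) * φ.quantum))) ^ 2 :=
  (valueSet_stochasticA_all φ ((valueSet_stochasticA_driftAntitone_iff φ ht N).1 h) x n s hns).2

end Summit.Ventures.CertifiedArithmetic.LowPrec.SR.LimitedBits

/-! ### Instances: the catalogued formats -/

namespace Summit.Ventures.CertifiedArithmetic.LowPrec.SR.Formats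

open Literature.ComputerArithmetic.FloatingPoint
open Literature.ComputerArithmetic.FloatingPoint.MiniFloat (valueSet)
open Summit.Ventures.CertifiedArithmetic.LowPrec.SR LimitedBits

/-- FP4 E2M1 (value set `FP4.e2m1`): drift-antitone on every unsaturated tree iff `N ≥ 2`. -/
theorem e2m1_stochasticA_iff (N : ℕ) :
    (∀ (x : ℕ → ℚ) (n : ℕ) (s : ℚ), NoSat FP4.e2m1 x n s → DriftAntitone FP4.e2m1 (probAwayA N) x n s) ↔
      2 ≤ N := by
  rw [e2m1_eq_valueSet]; exact valueSet_stochasticA_driftAntitone_iff Format.E2M1 (by decide) N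

/-- FP6 E2M3: iff `N ≥ 2`. -/
theorem e2m3_stochasticA_iff (N : ℕ) :
    (∀ (x : ℕ → ℚ) (n : ℕ) (s : ℚ), NoSat e2m3 x n s → DriftAntitone e2m3 (probAwayA N) x n s) ↔
      2 ≤ N := by
  rw [e2m3_eq_valueSet]; exact valueSet_stochasticA_driftAntitone_iff Format.E2M3 (by decide) N

/-- FP6 E3M2: iff `N ≥ 6`. -/
theorem e3m2_stochasticA_iff (N : ℕ) :
    (∀ (x : ℕ → ℚ) (n : ℕ) (s : ℚ), NoSat e3m2 x n s → DriftAntitone e3m2 (probAwayA N) x n s) ↔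
      6 ≤ N := by
  rw [e3m2_eq_valueSet]; exact valueSet_stochasticA_driftAntitone_iff Format.E3M2 (by decide) N

/-- FP8 E4M3 (OCP): iff `N ≥ 14`. -/
theorem e4m3_stochasticA_iff (N : ℕ) :
    (∀ (x : ℕ → ℚ) (n : ℕ) (s : ℚ), NoSat e4m3 x n s → DriftAntitone e4m3 (probAwayA N) x n s) ↔
      14 ≤ N := by
  rw [e4m3_eq_valueSet]; exact valueSet_stochasticA_driftAntitone_iff Format.E4M3 (by decide) N

/-- FP8 E5M2: iff `N ≥ 29`. -/
theorem e5m2_stochasticA_iff (N : ℕ) :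
    (∀ (x : ℕ → ℚ) (n : ℕ) (s : ℚ), NoSat e5m2 x n s → DriftAntitone e5m2 (probAwayA N) x n s) ↔
      29 ≤ N := by
  rw [e5m2_eq_valueSet]; exact valueSet_stochasticA_driftAntitone_iff Format.E5M2 (by decide) N

/-- binary16: iff `N ≥ 29`. -/
theorem binary16_stochasticA_iff (N : ℕ) :
    (∀ (x : ℕ → ℚ) (n : ℕ) (s : ℚ), NoSat (valueSet Format.Binary16) x n s →
        DriftAntitone (valueSet Format.Binary16) (probAwayA N) x n s) ↔ 29 ≤ N :=
  valueSet_stochasticA_driftAntitone_iff Format.Binary16 (by decide) N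

/-- bfloat16: iff `N ≥ 253`. -/
theorem bfloat16_stochasticA_iff (N : ℕ) :
    (∀ (x : ℕ → ℚ) (n : ℕ) (s : ℚ), NoSat (valueSet Format.BFloat16) x n s →
        DriftAntitone (valueSet Format.BFloat16) (probAwayA N) x n s) ↔ 253 ≤ N :=
  valueSet_stochasticA_driftAntitone_iff Format.BFloat16 (by decide) N

/-- binary32: iff `N ≥ 253`. -/
theorem binary32_stochasticA_iff (N : ℕ) :
    (∀ (x : ℕ → ℚ) (n : ℕ) (s : ℚ), NoSat (valueSet Format.Binary32) x n s →
        DriftAntitone (valueSet Format.Binary32) (probAwayA N) x n s) ↔ 253 ≤ N :=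
  valueSet_stochasticA_driftAntitone_iff Format.Binary32 (by decide) N

end Summit.Ventures.CertifiedArithmetic.LowPrec.SR.Formats
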